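import Summits.CriticalPhenomena.SAWScalingLimit.Theses.SAWReversalUpgrade
import Literature.Probability.RandomPlanarGeometry.LoewnerDescriptionProofs
import Literature.Probability.RandomPlanarGeometry.LocalMartingaleProofs
import HarnessLib

/-!
# Negative lemma for crux `PathUpgradeR` (stmt-CriticalPhenomena-18055, route `SAWReversalUpgrade`)

Load-bearing analysis, refuter side (cdisprove), for the repaired path upgrade
`Summit.CriticalPhenomena.SAWScalingLimit.Theses.SAWReversalUpgrade.PathUpgradeR`
(H1 eventually probability, H2 eventually a.e.-measurable classes, H3 eventually simple from `a`
to `b` with interior in `D`, H4/H5 forward and reversed chordal driving functions converge in law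
on every `[0, T]` to `√(8/3) B`, H6 no deep return to `a`, H7 no escape from `b`
`⟹ ConvergesInLawToSLE (8/3) D (mk ∘ X) P`).

* `not_convergesInLawToSLE_const` — **the conclusion of the crux is not Dirac-satisfiable**: for
  `κ > 0`, no eventually-probability family of laws makes a CONSTANT family of curve classes
  converge in law to chordal SLE_κ (`ConvergesInLawToSLE κ D (fun δ ω ↦ c₀) P` is false). Proof:
  convergence in law of a constant tested against the bounded continuous `min (dist · c₀) 1`
  forces the SLE curve `Γ` to equal `c₀` a.s.; an SLE curve is a.s. Loewner-described by its own
  driving function `√κ B` (definition of `IsSLECurve`), so by uniqueness of the driving function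
  of a curve class (`IsLoewnerDescribed.driving_unique_holds`) `√κ B` is a.s. equal to one fixed
  path, whence `B₁` is a.s. constant — impossible, its law is `gaussianReal 0 1`
  (`Process.hasLaw_brownian_sub`), which has no atoms.
* `pathUpgradeR_false_without_driving` — **H4 ∧ H5 are load-bearing**: the statement obtained from
  `PathUpgradeR` by deleting BOTH driving-convergence hypotheses (keeping H1, H2, H3, H6, H7
  verbatim) is FALSE. Witness: `D` the unit disc `(𝔻; 1, −1)`, `Ω δ = Unit`, `P δ = δ_()`,
  `X δ () =` the diameter `t ↦ 1 − 2t` (simple, from `a = 1` to `b = −1`, interior in the open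
  disc, never returns towards `a`, never escapes from `b`), and `not_convergesInLawToSLE_const`.
  In words: simplicity + the two endpoint windows + measurability carry NO convergence content;
  everything sits in the two driving hypotheses (and, by the paper witnesses recorded in the
  crux's `Disproof.lean` — N-curve for H6/H7, Lawler (2005) Ex. 4.49 for H5 — each of H4, H5, H6,
  H7 is separately load-bearing, but those witnesses need SLE surgery and are not kernel-checked).

No new definition; axioms `propext`, `Classical.choice`, `Quot.sound`.
-/

noncomputable section

open Set Filter Topology MeasureTheory ProbabilityTheory
open Literature.Probability.RandomPlanarGeometry Literature.Probability
open scoped NNReal unitInterval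

namespace Summit.CriticalPhenomena.SAWScalingLimit.Theorems.PathUpgradeR.Negative

/-! ### The SLE law is not a point mass -/

/-- The canonical Brownian motion at time `1` is not a.s. equal to a constant: its law is the
centred Gaussian of variance `1`, which charges no point. [folklore] -/
theorem not_ae_brownian_one_eq_const (x₀ : ℝ) :
    ¬ (∀ᵐ ω ∂Process.preWienerMeasure, Process.brownian 1 ω = x₀) := by
  intro hae
  haveI : IsProbabilityMeasure Process.preWienerMeasure := isProbabilityMeasure_preWienerMeasure'
  have hlaw := Process.hasLaw_brownian_sub exists_isBrownianReal_measurable_continuous_holds 1 0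
  have hsub : Process.brownian 1 - Process.brownian 0 = Process.brownian 1 := by
    rw [Process.brownian_zero, sub_zero]
  rw [hsub] at hlaw
  have hv : nndist (1 : ℝ≥0).1 (0 : ℝ≥0).1 = 1 := by ext; simp
  rw [hv] at hlaw
  have hmap : Process.preWienerMeasure.map (Process.brownian 1) = Measure.dirac x₀ := by
    rw [Measure.map_congr hae, Measure.map_const, measure_univ, one_smul]
  have hgauss : gaussianReal 0 1 = Measure.dirac x₀ := hlaw.map_eq.symm.trans hmap
  haveI : NullSingletonClass (gaussianReal (0 : ℝ) 1) := nullSingletonClass_gaussianReal one_ne_zero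
  have h0 : gaussianReal (0 : ℝ) 1 {x₀} = 0 := measure_singleton x₀
  rw [hgauss, Measure.dirac_apply_of_mem (mem_singleton x₀)] at h0
  exact one_ne_zero h0

/-- **An SLE_κ random curve (`κ > 0`) is not a.s. constant.** If `Γ` is a chordal SLE_κ curve of
`(D; a, b)` then `Γ` is not a.e. equal to a fixed class `c₀`: a.s. `Γ ω` is described through the
uniformizer by the driving function `√κ B(ω)` (definition of `IsSLECurve`), two describing
driving functions of one class coincide (`IsLoewnerDescribed.driving_unique_holds`), so `√κ B`
would be a.s. one fixed path and `B₁` a.s. constant (`not_ae_brownian_one_eq_const`). [folklore] -/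
theorem IsSLECurve.not_ae_eq_const {κ : ℝ≥0} (hκ : 0 < κ) {D : DobrushinDomain}
    {Γ : (ℝ≥0 → ℝ) → CurveClass ℂ} (hΓ : IsSLECurve κ D Γ) (c₀ : CurveClass ℂ) :
    ¬ (∀ᵐ ω ∂Process.preWienerMeasure, Γ ω = c₀) := by
  intro hae
  haveI : IsProbabilityMeasure Process.preWienerMeasure := isProbabilityMeasure_preWienerMeasure'
  obtain ⟨-, φ, hφ, hsle⟩ := hΓ
  have hdesc : ∀ᵐ ω ∂Process.preWienerMeasure, IsLoewnerDescribed φ c₀ (sleDriving κ ω) := by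
    filter_upwards [hae, hsle] with ω h1 h2
    obtain ⟨hgen, c, hc, hI⟩ := h2
    exact ⟨continuous_sleDriving κ ω, sleTrace κ ω, hgen, c, h1 ▸ hc, hI⟩
  obtain ⟨ω₀, hω₀⟩ := hdesc.exists
  have hconst : ∀ᵐ ω ∂Process.preWienerMeasure, Process.brownian 1 ω = Process.brownian 1 ω₀ := by
    filter_upwards [hdesc] with ω hω
    have heq : sleDriving κ ω = sleDriving κ ω₀ := IsLoewnerDescribed.driving_unique_holds hφ hω hω₀
    have h1 := congrFun heq 1
    simp only [sleDriving_apply] at h1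
    have hsq : Real.sqrt κ ≠ 0 := (Real.sqrt_pos.2 (NNReal.coe_pos.2 hκ)).ne'
    exact mul_left_cancel₀ hsq h1
  exact not_ae_brownian_one_eq_const _ hconst

/-- **The conclusion of `PathUpgradeR` is not Dirac-satisfiable**: for `κ > 0`, a constant family
of curve classes under eventually-probability laws never converges in law to chordal SLE_κ
(test `ConvergesInLawToSLE` against `min (dist · c₀) 1`: the SLE curve would be a.s. `c₀`,
contradicting `IsSLECurve.not_ae_eq_const`). [folklore] -/
theorem not_convergesInLawToSLE_const {κ : ℝ≥0} (hκ : 0 < κ) (D : DobrushinDomain)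
    {Ω : ℝ → Type*} [∀ δ, MeasurableSpace (Ω δ)] (P : (δ : ℝ) → Measure (Ω δ))
    (c₀ : CurveClass ℂ) :
    ¬ ConvergesInLawToSLE κ D (fun δ (_ : Ω δ) => c₀) P := by
  rintro ⟨Γ, hΓ, -, hT⟩
  haveI : IsProbabilityMeasure Process.preWienerMeasure := isProbabilityMeasure_preWienerMeasure'
  -- the bounded continuous test function `x ↦ min (dist x c₀) 1`
  obtain ⟨f, hf⟩ : ∃ f : BoundedContinuousFunction (CurveClass ℂ) ℝ,
      ∀ x, f x = min (dist x c₀) 1 := by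
    refine ⟨BoundedContinuousFunction.mkOfBound
      ⟨fun x => min (dist x c₀) 1, (continuous_id.dist continuous_const).min continuous_const⟩ 1
      ?_, fun x => rfl⟩
    intro x y
    simp only [ContinuousMap.coe_mk, Real.dist_eq]
    have hx0 : 0 ≤ min (dist x c₀) 1 := le_min dist_nonneg zero_le_one
    have hy0 : 0 ≤ min (dist y c₀) 1 := le_min dist_nonneg zero_le_one
    have hx1 : min (dist x c₀) 1 ≤ 1 := min_le_right _ _
    have hy1 : min (dist y c₀) 1 ≤ 1 := min_le_right _ _
    rw [abs_sub_le_iff]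
    constructor <;> linarith
  have hf0 : f c₀ = 0 := by rw [hf, dist_self, min_eq_left zero_le_one]
  have hfnn : ∀ x, 0 ≤ f x := fun x => by rw [hf]; exact le_min dist_nonneg zero_le_one
  have hfle : ∀ x, f x ≤ 1 := fun x => by rw [hf]; exact min_le_right _ _
  have hfeq : ∀ x, f x = 0 → x = c₀ := by
    intro x h
    rw [hf] at h
    rcases min_eq_iff.1 h with h1 | h1
    · exact dist_eq_zero.1 h1.1
    · exact absurd h1.1 one_ne_zero
  have hlim := hT f
  have hzero : (fun δ => ∫ _ω, f c₀ ∂P δ) = fun _ => (0 : ℝ) := by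
    funext δ
    rw [hf0, integral_zero]
  rw [hzero] at hlim
  have hint : ∫ ω, f (Γ ω) ∂Process.preWienerMeasure = 0 :=
    tendsto_nhds_unique hlim tendsto_const_nhds
  have hmeas : AEStronglyMeasurable (fun ω => f (Γ ω)) Process.preWienerMeasure :=
    f.continuous.comp_aestronglyMeasurable hΓ.1.aestronglyMeasurable
  have hintegrable : Integrable (fun ω => f (Γ ω)) Process.preWienerMeasure := by
    refine Integrable.of_bound hmeas 1 (Eventually.of_forall fun ω => ?_)
    rw [Real.norm_eq_abs, abs_of_nonneg (hfnn _)]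
    exact hfle _
  have hae0 : (fun ω => f (Γ ω)) =ᵐ[Process.preWienerMeasure] 0 :=
    (integral_eq_zero_iff_of_nonneg_ae (Eventually.of_forall fun ω => hfnn _) hintegrable).1 hint
  have hae : ∀ᵐ ω ∂Process.preWienerMeasure, Γ ω = c₀ := by
    filter_upwards [hae0] with ω hω
    exact hfeq _ hω
  exact IsSLECurve.not_ae_eq_const hκ hΓ c₀ hae

/-! ### The deterministic witness: the diameter of the unit disc -/

/-- The diameter of the unit disc from `1` to `−1` is `t ↦ 1 − 2t`. [folklore] -/
theorem segment_apply' (t : I) : Curve.segment (1 : ℂ) (-1) t = 1 - 2 * ((t : ℝ) : ℂ) := by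
  rw [Curve.segment_apply]; ring

/-- Along the diameter the distance to `1` is `2t` (increasing). [folklore] -/
theorem dist_segment_one (t : I) : dist (Curve.segment (1 : ℂ) (-1) t) 1 = 2 * (t : ℝ) := by
  rw [segment_apply', Complex.dist_eq]
  have : (1 : ℂ) - 2 * ((t : ℝ) : ℂ) - 1 = ((-(2 * (t : ℝ)) : ℝ) : ℂ) := by push_cast; ring
  rw [this, Complex.norm_real, Real.norm_eq_abs, abs_neg, abs_of_nonneg (mul_nonneg zero_le_two t.2.1)]

/-- Along the diameter the distance to `−1` is `2(1 − t)` (decreasing). [folklore] -/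
theorem dist_segment_neg_one (t : I) :
    dist (Curve.segment (1 : ℂ) (-1) t) (-1) = 2 * (1 - (t : ℝ)) := by
  rw [segment_apply', Complex.dist_eq]
  have : (1 : ℂ) - 2 * ((t : ℝ) : ℂ) - -1 = ((2 * (1 - (t : ℝ)) : ℝ) : ℂ) := by push_cast; ring
  rw [this, Complex.norm_real, Real.norm_eq_abs, abs_of_nonneg]
  have := t.2.2
  nlinarith

/-- The diameter is a simple curve. [folklore] -/
theorem segment_injective : Function.Injective (Curve.segment (1 : ℂ) (-1)) := by
  intro s t h
  rw [segment_apply', segment_apply'] at h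
  have h' : ((s : ℝ) : ℂ) = ((t : ℝ) : ℂ) := by
    have h2 : (2 : ℂ) * ((s : ℝ) : ℂ) = 2 * ((t : ℝ) : ℂ) := by
      have := congrArg (fun z : ℂ => 1 - z) h
      simpa using this
    exact mul_left_cancel₀ two_ne_zero h2
  exact Subtype.ext (Complex.ofReal_injective h')

/-- The diameter runs from `1` to `−1` through the open unit disc. [folklore] -/
theorem segment_mem (t : I) :
    Curve.segment (1 : ℂ) (-1) t = 1 ∨ Curve.segment (1 : ℂ) (-1) t = -1 ∨
      Curve.segment (1 : ℂ) (-1) t ∈ Metric.ball (0 : ℂ) 1 := by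
  rcases eq_or_lt_of_le t.2.1 with h0 | h0
  · left
    rw [segment_apply', ← h0]; simp
  rcases eq_or_lt_of_le t.2.2 with h1 | h1
  · right; left
    rw [segment_apply', h1]; push_cast; ring
  · right; right
    rw [Metric.mem_ball, dist_zero_right, segment_apply']
    have : (1 : ℂ) - 2 * ((t : ℝ) : ℂ) = ((1 - 2 * (t : ℝ) : ℝ) : ℂ) := by push_cast; ring
    rw [this, Complex.norm_real, Real.norm_eq_abs, abs_lt]
    constructor <;> linarith

/-- **H4 ∧ H5 (bidirectional driving convergence) are load-bearing in `PathUpgradeR`**: the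
statement with both driving hypotheses deleted — H1, H2, H3, H6, H7 `⟹ ConvergesInLawToSLE` —
is false. Witness: the unit disc `(𝔻; 1, −1)` with any uniformizers, `Ω δ = Unit`, `P δ = δ_()`,
`X δ () = ` the diameter from `1` to `−1`; H6/H7 hold with `r = ε/2` (the distance to `1` is
monotone increasing, the distance to `−1` monotone decreasing along the diameter), and the
conclusion fails by `not_convergesInLawToSLE_const`. [folklore] -/
theorem pathUpgradeR_false_without_driving :
    ¬ (∀ (D : DobrushinDomain) (φ : ConformalEquiv UpperHalfPlane.upperHalfPlaneSet D.carrier),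
        D.IsChordalUniformizing φ →
      ∀ (φ' : ConformalEquiv UpperHalfPlane.upperHalfPlaneSet D.swap.carrier),
        D.swap.IsChordalUniformizing φ' →
      ∀ (Ω : ℝ → Type) [∀ δ, MeasurableSpace (Ω δ)] (X : (δ : ℝ) → Ω δ → Curve ℂ)
        (P : (δ : ℝ) → MeasureTheory.Measure (Ω δ)),
      (∀ᶠ δ in (nhdsWithin (0:ℝ) (Set.Ioi 0)), MeasureTheory.IsProbabilityMeasure (P δ)) →
      (∀ᶠ δ in (nhdsWithin (0:ℝ) (Set.Ioi 0)),
        AEMeasurable (fun ω => CurveClass.mk (X δ ω)) (P δ)) →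
      (∀ᶠ δ in (nhdsWithin (0:ℝ) (Set.Ioi 0)), ∀ ω : Ω δ, Function.Injective (X δ ω) ∧
        (X δ ω).source = D.pt 0 ∧ (X δ ω).target = D.pt 1 ∧
        ∀ t : unitInterval, X δ ω t = D.pt 0 ∨ X δ ω t = D.pt 1 ∨ X δ ω t ∈ D.carrier) →
      (∀ ε : ℝ, 0 < ε → ∀ η : ℝ, 0 < η → ∃ r : ℝ, 0 < r ∧ ∀ᶠ δ in (nhdsWithin (0:ℝ) (Set.Ioi 0)),
        P δ {ω | ∃ s t : unitInterval, s < t ∧ ε ≤ dist (X δ ω s) (D.pt 0) ∧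
          dist (X δ ω t) (D.pt 0) ≤ r} ≤ ENNReal.ofReal η) →
      (∀ ε : ℝ, 0 < ε → ∀ η : ℝ, 0 < η → ∃ r : ℝ, 0 < r ∧ ∀ᶠ δ in (nhdsWithin (0:ℝ) (Set.Ioi 0)),
        P δ {ω | ∃ s t : unitInterval, s < t ∧ dist (X δ ω s) (D.pt 1) ≤ r ∧
          ε ≤ dist (X δ ω t) (D.pt 1)} ≤ ENNReal.ofReal η) →
      ConvergesInLawToSLE ((8:NNReal)/3) D (fun δ (ω : Ω δ) => CurveClass.mk (X δ ω)) P) := by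
  intro h
  set D := DobrushinDomain.unitDisc with hD
  obtain ⟨φ, hφ⟩ := MarkedDomain.exists_isChordalUniformizing_holds D
  obtain ⟨φ', hφ'⟩ := MarkedDomain.exists_isChordalUniformizing_holds D.swap
  -- the marked points of `(𝔻; 1, −1)` (also `Literature.Barriers…SupercriticalSAWSpaceFillingReversible.unitDisc_pt_zero'/one'`)
  have h0 : D.pt 0 = 1 := by
    simp [hD, MarkedDomain.pt, DobrushinDomain.unitDisc, JordanDomain.unitDisc, circleMap]
  have h1 : D.pt 1 = -1 := by
    have h : D.pt 1 = Complex.exp (2 * (Real.pi : ℂ) * 2⁻¹ * Complex.I) := by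
      simp [hD, MarkedDomain.pt, DobrushinDomain.unitDisc, JordanDomain.unitDisc, circleMap]
    have h' : (2 : ℂ) * (Real.pi : ℂ) * 2⁻¹ * Complex.I = Real.pi * Complex.I := by ring
    rw [h, h', Complex.exp_pi_mul_I]
  have hconv := h D φ hφ φ' hφ' (fun _ => Unit) (fun _ _ => Curve.segment (1 : ℂ) (-1))
    (fun _ => Measure.dirac ()) (Eventually.of_forall fun _ => Measure.dirac.isProbabilityMeasure)
    (Eventually.of_forall fun _ => aemeasurable_const) ?_ ?_ ?_
  · exact not_convergesInLawToSLE_const (by positivity) D _ _ hconv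
  · refine Eventually.of_forall fun δ ω => ⟨segment_injective, ?_, ?_, ?_⟩
    · rw [h0, Curve.source_def, segment_apply']; simp
    · rw [h1, Curve.target_def, segment_apply']; push_cast; ring
    · intro t
      rw [h0, h1]
      exact segment_mem t
  · intro ε hε η hη
    refine ⟨ε / 2, by positivity, Eventually.of_forall fun δ => ?_⟩
    have hempty : {ω : Unit | ∃ s t : unitInterval, s < t ∧
        ε ≤ dist (Curve.segment (1 : ℂ) (-1) s) (D.pt 0) ∧
        dist (Curve.segment (1 : ℂ) (-1) t) (D.pt 0) ≤ ε / 2} = ∅ := by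
      ext ω
      simp only [mem_setOf_eq, mem_empty_iff_false, iff_false, not_exists, not_and, not_le]
      intro s t hst hs
      rw [h0, dist_segment_one] at hs ⊢
      have : (s : ℝ) < (t : ℝ) := hst
      linarith
    rw [hempty, measure_empty]
    exact zero_le
  · intro ε hε η hη
    refine ⟨ε / 2, by positivity, Eventually.of_forall fun δ => ?_⟩
    have hempty : {ω : Unit | ∃ s t : unitInterval, s < t ∧
        dist (Curve.segment (1 : ℂ) (-1) s) (D.pt 1) ≤ ε / 2 ∧
        ε ≤ dist (Curve.segment (1 : ℂ) (-1) t) (D.pt 1)} = ∅ := by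
      ext ω
      simp only [mem_setOf_eq, mem_empty_iff_false, iff_false, not_exists, not_and, not_le]
      intro s t hst hs
      rw [h1, dist_segment_neg_one] at hs ⊢
      have : (s : ℝ) < (t : ℝ) := hst
      linarith
    rw [hempty, measure_empty]
    exact zero_le

end Summit.CriticalPhenomena.SAWScalingLimit.Theorems.PathUpgradeR.Negative

end
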